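import Literature.Computability.Complexity.CNFToCMMSA
import Literature.Computability.Complexity.CSPToCMMSAMachine
import Literature.Computability.Complexity.CodeFPBudgets
import Literature.Computability.Complexity.PromiseProofs
import HarnessLib

/-!
# Gap-E3SAT as constant-gap CMMSA, II: the embedding is a Karp reduction

Topic `Computability/Complexity`. The embedding `CNFToCMMSA.toCMMSA` of `CNFToCMMSA.lean` is computed
on codes (`encodingCNF` → `CMMSAInstance.encoding`) by a polynomial-time string function, written in
the typed `CodeFP` algebra (`CodeFP.lean`, `CodeFPBudgets.lean`): the first-occurrence index
`firstIdx` is a fold with an accumulator `(k, found)` of size `O(|input|)`, everything else is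
`map` / `flatten` / `filter` / `ulength` plumbing. Consequently NP-hardness of `gapE3SAT ε`
(`ε < 1/8`: Håstad 2001, Thm. 6.5, or any weaker gap from the PCP theorem) transfers to the base
rung `gapCMMSA (baseGap ε) 1 3` of the self-improvement ladder (`CMMSASquaringMachine.lean`).

* `CNFToCMMSA.codeFP_firstIdx`, `codeFP_occW`, `codeFP_weights`, `codeFP_clauseFormula`, …;
* `CNFToCMMSA.codeFP_toCMMSA` — **`toCMMSA` is polynomial time on codes**;
* `CNFToCMMSA.polyTimeReducible_gapE3SAT` — **`gapE3SAT ε ≤ₚ gapCMMSA (baseGap ε) 1 3`** for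
  `ε < 1/8`, and `isNPHard_gapCMMSA_base_of_gapE3SAT`.

## References

* M. Alekhnovich, S. Buss, S. Moran, T. Pitassi, *Minimum propositional proof length is NP-hard to
  linearly approximate*, J. Symbolic Logic 66 (2001), §2 (MMSA and Minimum Hitting Set)
  [AlekhnovichEtAl2001].
* S. Hirahara, *NP-hardness of learning programs and partial MCSP*, ECCC TR22-119, Def. 5.1, proof
  of Thm. 5.2 [Hirahara2022PartialMCSP].
* J. Håstad, *Some optimal inapproximability results*, J. ACM 48 (2001), Thm. 6.5 [Hastad2001].
* S. Arora, B. Barak, *Computational Complexity: A Modern Approach*, CUP 2009, §1.3 [AroraBarak2009].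
-/

namespace Literature.Computability.Complexity

open _root_.Computability MetaComplexity CodeFP Polynomial
open CSPToCMMSAMachine (TO toE toE_eq)

namespace CNFToCMMSA

/-! ### Codes -/

/-- Re-heading a raw formula. [folklore] -/
theorem codeFP_fList : CodeFP (rawE (rawE natE)) (listE (listE natE)) id :=
  ((listOfRaw (listE natE)).comp (map₀ (listOfRaw natE))).congr fun φ => by simp

/-- Re-heading a raw collection. [folklore] -/
theorem codeFP_collList : CodeFP (rawE (rawE (rawE natE))) (listE (listE (listE natE))) id :=
  ((listOfRaw (listE (listE natE))).comp (map₀ codeFP_fList)).congr fun Φ => by simp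

/-- `encodingCNF` codes by `listE (listE (pairE natE bitE))`. [folklore] -/
theorem cnfE_eq : (encodingCNF.encode : CNF ℕ → List Bool) = listE (listE (pairE natE bitE)) := by
  simp only [encodingCNF, encodingClause, encodingLiteral, listE_eq, pairE_eq, natE_eq, bitE_eq]

/-- Re-reading a coded CNF raw. [folklore] -/
theorem codeFP_cnfRaw : CodeFP (listE (listE (pairE natE bitE))) (rawE (rawE (pairE natE bitE))) id :=
  ((map₀ (rawOfList (pairE natE bitE))).comp (rawOfList (listE (pairE natE bitE)))).congr fun φ => by simp

/-- `varList` on raw CNFs. [folklore] -/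
theorem codeFP_varList : CodeFP (rawE (rawE (pairE natE bitE))) (rawE natE) varList :=
  ((map₀ (fst natE bitE)).comp (flatten (pairE natE bitE))).congr fun _ => rfl

/-! ### The first-occurrence index -/

/-- **`firstIdx v V` is computed in polynomial time** (`(v, V) ↦ firstIdx v V`; a fold whose
accumulator is an index `≤ |V|` and a bit). [cite: AroraBarak2009, §1.3 (bounded loops)] -/
theorem codeFP_firstIdx : CodeFP (pairE natE (rawE natE)) natE (fun p => firstIdx p.1 p.2) := by
  have hK : CodeFP (pairE natE (pairE natE (pairE natE bitE))) natE (fun t => t.2.2.1) := (snd _ _).snd'.fst'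
  have hF : CodeFP (pairE natE (pairE natE (pairE natE bitE))) bitE (fun t => t.2.2.2) := (snd _ _).snd'.snd'
  have hEq : CodeFP (pairE natE (pairE natE (pairE natE bitE))) bitE (fun t => decide (t.2.1 = t.1)) :=
    natEq.comp ((snd _ _).fst'.pair (fst _ _))
  have hstep : CodeFP (pairE natE (pairE natE (pairE natE bitE))) (pairE natE bitE)
      (fun t => idxStep t.1 t.2.1 t.2.2) :=
    (hF.ite (snd _ _).snd' (hEq.ite (hK.pair (const _ true))
      ((natAdd.comp (hK.pair (const _ 1))).pair (const _ false)))).congr fun t => by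
        simp only [idxStep]
        split_ifs <;> simp_all
  have h := foldl (step := fun v a st => idxStep v a st) (init := fun _ => ((0 : ℕ), false)) hstep
    (const natE (0, false)) (2 * X + 3) (fun v l₁ l₂ => by
      rw [(foldl_idxStep v l₁ 0).1, zero_add]
      have ha := length_natE_le (firstIdx v l₁)
      have hb := firstIdx_le_length v l₁
      have hc := length_le_length_rawE natE (l₁ ++ l₂)
      have hd : (pairE natE (rawE natE) (v, l₁ ++ l₂)).length =
          2 * (natE v).length + 2 + (rawE natE (l₁ ++ l₂)).length := by
        rw [pairE_apply, length_boolPair]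
      have he : (pairE natE bitE (firstIdx v l₁, decide (v ∈ l₁))).length =
          2 * (natE (firstIdx v l₁)).length + 2 + 1 := by
        rw [pairE_apply, length_boolPair]; rfl
      rw [List.length_append] at hc
      rw [hd, he]
      simp only [eval_add, eval_mul, eval_ofNat, eval_X]
      omega)
  exact (h.fst'.comp ((fst _ _).pair (snd _ _))).congr fun p => by
    simp only
    rw [(foldl_idxStep p.1 p.2 0).1, zero_add]

/-! ### The fields -/

/-- `litVar V l` with context `V`. [cite: Hirahara2022PartialMCSP, proof of Thm. 5.2 (literals L_{x,a})] -/
theorem codeFP_litVar : CodeFP (pairE (rawE natE) (pairE natE bitE)) natE (fun p => litVar p.1 p.2) := by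
  have hidx : CodeFP (pairE (rawE natE) (pairE natE bitE)) natE (fun p => firstIdx p.2.1 p.1) :=
    codeFP_firstIdx.comp ((snd _ _).fst'.pair (fst _ _))
  have hbit : CodeFP (pairE (rawE natE) (pairE natE bitE)) natE (fun p => if p.2.2 then 1 else 0) :=
    (snd _ _).snd'.ite (const _ 1) (const _ 0)
  exact (natAdd.comp ((natMul.comp ((const _ 2).pair hidx)).pair hbit)).congr fun p => by
    unfold litVar
    cases p.2.2 <;> rfl

/-- `clauseFormula V C` with context `V`. [cite: AlekhnovichEtAl2001, §2] -/
theorem codeFP_clauseFormula : CodeFP (pairE (rawE natE) (rawE (pairE natE bitE))) (rawE (rawE natE)) (fun p => clauseFormula p.1 p.2) :=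
  (map ((rawSingleton natE).comp codeFP_litVar)).congr fun _ => rfl

/-- `totFormula u`. [cite: Hirahara2022PartialMCSP, proof of Thm. 5.2] -/
theorem codeFP_totFormula : CodeFP natE (rawE (rawE natE)) totFormula := by
  have h2u : CodeFP natE natE (fun u => 2 * u) := natMul.comp ((const natE 2).pair (CodeFP.id natE))
  have ht1 : CodeFP natE (rawE natE) (fun u => [2 * u]) := (rawSingleton natE).comp h2u
  have ht2 : CodeFP natE (rawE natE) (fun u => [2 * u + 1]) :=
    (rawSingleton natE).comp (natAdd.comp (h2u.pair (const natE 1)))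
  exact ((rawCons (rawE natE)).comp (ht1.pair ((rawSingleton (rawE natE)).comp ht2))).congr fun _ => rfl

/-- `occW V u` (unary) on `(V, u)`. [cite: Hirahara2022PartialMCSP, proof of Thm. 5.2 (w(L_{x,a}) = |Ψ(x)|)] -/
theorem codeFP_occW : CodeFP (pairE (rawE natE) natE) unE (fun p => occW p.1 p.2) := by
  have hp : CodeFP (pairE (pairE (rawE natE) natE) natE) bitE (fun t => decide (firstIdx t.2 t.1.1 = t.1.2)) :=
    natEq.comp ((codeFP_firstIdx.comp ((snd _ _).pair (fst _ _).fst')).pair (fst _ _).snd')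
  have h := filter hp
  exact ((ulength natE).comp (h.comp ((CodeFP.id _).pair (fst _ _)))).congr fun p => by
    obtain ⟨V, u⟩ := p
    show (V.filter fun a => decide (firstIdx a V = u)).length = occW V u
    rw [occW, List.countP_eq_length_filter]

/-- `weights V` (raw unary list). [cite: Hirahara2022PartialMCSP, proof of Thm. 5.2 (p. 17)] -/
theorem codeFP_weights : CodeFP (rawE natE) (rawE unE) weights := by
  have hw : CodeFP (pairE (rawE natE) natE) unE (fun p => occW p.1 p.2) := codeFP_occW
  have hrow : CodeFP (pairE (rawE natE) natE) (rawE unE) (fun p => [occW p.1 p.2, occW p.1 p.2]) :=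
    (rawCons unE).comp (hw.pair ((rawSingleton unE).comp hw))
  have hrange : CodeFP (rawE natE) (rawE natE) (fun V => List.range V.length) := urange.comp (ulength natE)
  exact ((flatten unE).comp ((map hrow).comp ((CodeFP.id _).pair hrange))).congr fun _ => rfl

/-! ### The instance map -/

/-- **The embedding on raw CNFs, valued in instance tuples
`(2N, clause formulas ++ totality formulas, weights, N)`, is polynomial time on codes.**
[cite: AlekhnovichEtAl2001, §2; Hirahara2022PartialMCSP, proof of Thm. 5.2; AroraBarak2009, §1.3] -/
theorem codeFP_cnfT : CodeFP (rawE (rawE (pairE natE bitE))) toE (fun φ : CNF ℕ => ((2 * (varList φ).length,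
    φ.map (clauseFormula (varList φ)) ++ (List.range (varList φ).length).map totFormula,
    weights (varList φ), (varList φ).length) : TO)) := by
  have hV : CodeFP (rawE (rawE (pairE natE bitE))) (rawE natE) varList := codeFP_varList
  have hN : CodeFP (rawE (rawE (pairE natE bitE))) natE (fun φ => (varList φ).length) := (natLength natE).comp hV
  have h1 : CodeFP (rawE (rawE (pairE natE bitE))) natE (fun φ => 2 * (varList φ).length) := natMul.comp ((const _ 2).pair hN)
  have hcl : CodeFP (rawE (rawE (pairE natE bitE))) (rawE (rawE (rawE natE))) (fun φ => φ.map (clauseFormula (varList φ))) :=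
    (map codeFP_clauseFormula).comp (hV.pair (CodeFP.id _))
  have htot : CodeFP (rawE (rawE (pairE natE bitE))) (rawE (rawE (rawE natE))) (fun φ => (List.range (varList φ).length).map totFormula) :=
    (map₀ codeFP_totFormula).comp (urange.comp ((ulength natE).comp hV))
  have h2 : CodeFP (rawE (rawE (pairE natE bitE))) (listE (listE (listE natE)))
      (fun φ => φ.map (clauseFormula (varList φ)) ++ (List.range (varList φ).length).map totFormula) :=
    (codeFP_collList.comp ((rawAppend (rawE (rawE natE))).comp (hcl.pair htot))).congr fun _ => rfl
  have h3 : CodeFP (rawE (rawE (pairE natE bitE))) (listE unE) (fun φ => weights (varList φ)) :=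
    ((listOfRaw unE).comp (codeFP_weights.comp hV)).congr fun _ => rfl
  exact (h1.pair (h2.pair (h3.pair hN))).congr fun _ => rfl

/-- **`toCMMSA` is computed on codes (`encodingCNF` → `CMMSAInstance.encoding`) by a
polynomial-time string function.** [cite: AroraBarak2009, §1.3; Hirahara2022PartialMCSP, proof of Thm. 5.2] -/
theorem codeFP_toCMMSA : CodeFP encodingCNF.encode CMMSAInstance.encoding.encode toCMMSA := by
  obtain ⟨f, hf, hfd⟩ := codeFP_cnfT.comp codeFP_cnfRaw
  refine ⟨f, hf, fun φ => ?_⟩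
  rw [cnfE_eq, CMMSAInstance.encoding_encode, toE_eq, hfd]
  rfl

/-! ### The Karp reduction -/

/-- **`gapE3SAT ε ≤ₚ gapCMMSA (baseGap ε) 1 3` for `ε < 1/8`.** [cite: AlekhnovichEtAl2001, §2 (proof of Thm. 3: "reduction from Satisfiability to approximation of MMSA"); Hastad2001, Thm. 6.5] -/
theorem polyTimeReducible_gapE3SAT {ε : ℚ} (hε : ε < 1 / 8) :
    (gapE3SAT ε).PolyTimeReducible (gapCMMSA (fun _ => baseGap ε) (fun _ => 1) fun _ => 3) := by
  obtain ⟨f, hf, hfφ⟩ := codeFP_toCMMSA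
  refine ⟨f, hf, ?_, ?_⟩
  · intro v hv
    rw [gapE3SAT_yes] at hv
    obtain ⟨φ, ⟨hE3, hsat⟩, rfl⟩ := hv
    rw [hfφ, gapCMMSA_yes]
    exact Set.mem_image_of_mem _ (toCMMSA_mem_yesSet hE3.isWidthLE hsat)
  · intro v hv
    rw [gapE3SAT_no] at hv
    obtain ⟨φ, ⟨hE3, hval⟩, rfl⟩ := hv
    rw [hfφ, gapCMMSA_no]
    exact Set.mem_image_of_mem _ (toCMMSA_mem_noSet hε hE3.isWidthLE hval)

/-- **NP-hardness of `gapE3SAT ε` (`ε < 1/8`) gives NP-hardness of `gapCMMSA (baseGap ε) 1 3`.**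
[cite: AlekhnovichEtAl2001, §2; Hastad2001, Thm. 6.5] -/
theorem isNPHard_gapCMMSA_base_of_gapE3SAT {ε : ℚ} (hε : ε < 1 / 8) (h : (gapE3SAT ε).IsNPHard) :
    (gapCMMSA (fun _ => baseGap ε) (fun _ => 1) fun _ => 3).IsNPHard :=
  PromiseProblem.IsHard.of_reducible_holds h (polyTimeReducible_gapE3SAT hε)

end CNFToCMMSA

end Literature.Computability.Complexity
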